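import Summits.CriticalPhenomena.PercolationContinuityZ3.Theorems.PercNearOneGluingNoHeavyLowerTailSahiE3UnionTensorLattice
import HarnessLib

/-!
# `NoHeavyLowerTail` (crux stmt-CriticalPhenomena-4575), Sahi programme P4: `E₃ ≥ 0` for the MIXED separable triple (OR, OR, AND) of two independent
# blocks — "`E₃` is Hadamard-positive in the mixed coordinates"

Support file (cell `prim-l12`, seat P4, generation 32; `--supports stmt-CriticalPhenomena-4575`).  No definitions, no named facts, no sorries; standard axioms.
Companions: `…SahiE3UnionTensor` / `…Measure` / `…Lattice` (all-OR and all-AND steps), `…Cube` (computational cube corollaries).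

THE POINT.  For two independent blocks `(X,μ)`, `(Y,ν)` and `[0,1]`-valued `a_i`, `b_i`, Sahi's third functional of a separable triple is a polynomial in a
few one-block moments, and in suitable coordinates it is the SAME polynomial as `E₃` of one block evaluated at the coordinatewise (Hadamard) product of
the two blocks' coordinate vectors: all-AND in the hold moments (the order-3 product formula), all-OR in the fail moments (`…SahiE3UnionTensor`), and for
(OR, OR, AND) in the coordinates `(x_0, x_1, x_01; α; P_0, P_1, P_01)` — fail masses of members `0,1`, the mass `α` of member `2`, and
`P_0 = E[(1−a_0)a_2]`, `P_1 = E[(1−a_1)a_2]`, `P_01 = E[(1−a_0)(1−a_1)a_2]`: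
  `E₃ = α(x_0 + x_1 − x_01 + x_0x_1) − P_0(1+x_1) − P_1(1+x_0) + 2P_01`   on one block, and
  `E₃(u) = αβ(z_0 + z_1 − x_01y_01 + z_0z_1) − (1+z_1)P_0Q_0 − (1+z_0)P_1Q_1 + 2P_01Q_01` (`z_i = x_iy_i`)   for the mixed triple on `X × Y`
(`e3MixedOOA_nonneg`; identity found by conditioning on the AND member).  Positivity ("Hadamard closure") is NOT termwise; an LP in the conditional fail
moments (this seat, kit j282529) produced the 22-pair certificate proved here by `ring`: `αβ·E₃(u)` is a sum of 44 products of Venn masses, the Harris rows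
`Cov(a_i,a_j) ≥ 0`, the hereditary row `Cov(a_0a_1,a_2) ≥ 0` and Sahi's row `E₃(a) ≥ 0` of the two sides.  So (`sahiE_three_ooa_nonneg`,
`sahiE_three_ooa_nonneg_of_sahiPositive_two`) `E₃ ≥ 0` passes to mixed separable triples with two unions and one product; with the all-OR and all-AND steps
every member-wise choice of gates at a block is covered except (OR, AND, AND) (LP certificate exists, kit j281478; structured proof pending).
HONEST FRAMING: closure theorems; nothing about `C₃` itself. [this work]
-/

noncomputable section

namespace Summit.CriticalPhenomena.PercolationContinuityZ3.Theorems.SahiE3UnionTensor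

open Finset Function Literature.Combinatorics.Sahi2008

/-- **`E₃` of a MIXED separable triple — two unions and one product — algebraic core.**  Coordinates per side: fail masses
`x_0,x_1,x_01` of members `0,1`, the mass `α` of member `2`, and `P_0 = E[a_2(1−a_0)]`, `P_1 = E[a_2(1−a_1)]`, `P_01 = E[a_2(1−a_0)(1−a_1)]`.
Hypotheses per side: Venn masses `≥ 0`, the Harris rows `Cov(a_0,a_2), Cov(a_1,a_2) ≥ 0` (`αx_i − P_i ≥ 0`), `Cov(a_0,a_1) ≥ 0`, the hereditary row
`Cov(a_0a_1,a_2) ≥ 0` and Sahi's row `E₃(a) ≥ 0`, the last two written in these coordinates.  Conclusion: Sahi's `E₃` of the slots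
`u_0 = a_0 ⊕ b_0 − a_0b_0`, `u_1 = a_1 ⊕ b_1 − a_1b_1`, `u_2 = a_2 ⊗ b_2`, written out in its joint moments, is `≥ 0`.  Proof: `αβ·E₃(u)` is an explicit
sum of 44 products of the nonnegative quantities (certificate found by LP in the conditional fail moments; "Hadamard closure" of `E₃`). [this work] -/
theorem e3MixedOOA_nonneg (x0 x1 x01 al P0 P1 P01 y0 y1 y01 be Q0 Q1 Q01 : ℝ)
    (hx0 : 0 ≤ x0) (hx1 : 0 ≤ x1) (hx0' : x0 ≤ 1) (hx01a : x01 ≤ x0) (hx01b : x01 ≤ x1) (hal : 0 ≤ al) (hP0 : 0 ≤ P0) (hP1 : 0 ≤ P1) (hP01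
    : 0 ≤ P01) (hP01a : P01 ≤ P0) (hP01b : P01 ≤ P1) (hT : 0 ≤ al - P0 - P1 + P01) (hK0 : 0 ≤ al*x0 - P0) (hK1 : 0 ≤ al*x1 - P1) (hR : 0 ≤
    (al*x0 - P0) + (al*x1 - P1) - (al*x01 - P01)) (hk : x0*x1 ≤ x01) (he : 0 ≤ al*(x0 + x1 - x01 + x0*x1) - P0*(1 + x1) - P1*(1 + x0) +
    2*P01)
    (hy0 : 0 ≤ y0) (hy1 : 0 ≤ y1) (hy0' : y0 ≤ 1) (hy01a : y01 ≤ y0) (hy01b : y01 ≤ y1) (hbe : 0 ≤ be) (hQ0 : 0 ≤ Q0) (hQ1 : 0 ≤ Q1) (hQ01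
    : 0 ≤ Q01) (hQ01a : Q01 ≤ Q0) (hQ01b : Q01 ≤ Q1) (hU : 0 ≤ be - Q0 - Q1 + Q01) (hL0 : 0 ≤ be*y0 - Q0) (hL1 : 0 ≤ be*y1 - Q1) (hS : 0 ≤
    (be*y0 - Q0) + (be*y1 - Q1) - (be*y01 - Q01)) (hl : y0*y1 ≤ y01) (hf : 0 ≤ be*(y0 + y1 - y01 + y0*y1) - Q0*(1 + y1) - Q1*(1 + y0) +
    2*Q01) :
    0 ≤ 2 * (al*be - P0*Q0 - P1*Q1 + P01*Q01) + (1 - x0*y0) * (1 - x1*y1) * (al*be) - ((1 - x0*y0) * (al*be - P1*Q1) + (1 - x1*y1) * (al*be - P0*Q0) + (al*be) * (1 - x0*y0 - x1*y1 + x01*y01)) := by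
  have key : al * be * (2 * (al*be - P0*Q0 - P1*Q1 + P01*Q01) + (1 - x0*y0) * (1 - x1*y1) * (al*be) - ((1 - x0*y0) * (al*be - P1*Q1) + (1 - x1*y1) * (al*be - P0*Q0) + (al*be) * (1 - x0*y0 - x1*y1 + x01*y01)))
      = (1/2 : ℝ) * ((al*x0 - P0) * al) * ((y0 - y01) * be * be)
        + (1/2 : ℝ) * ((x0 - x01) * al * al) * ((be*y0 - Q0) * be)
        + (1/2 : ℝ) * ((al*x0 - P0) * al) * ((be*y0 - Q0) * (be*y1 - Q1))
        + (1/2 : ℝ) * ((al*x0 - P0) * (al*x1 - P1)) * ((be*y0 - Q0) * be)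
        + (1/2 : ℝ) * ((al*x0 - P0) * al) * (Q0 * (Q0 - Q01))
        + (1/2 : ℝ) * (P0 * (P0 - P01)) * ((be*y0 - Q0) * be)
        + (1/2 : ℝ) * ((al*x0 - P0) * al) * ((Q0 - Q01) * (be - Q0 - Q1 + Q01))
        + (1/2 : ℝ) * ((P0 - P01) * (al - P0 - P1 + P01)) * ((be*y0 - Q0) * be)
        + (1/2 : ℝ) * ((al*x1 - P1) * al) * ((y1 - y01) * be * be)
        + (1/2 : ℝ) * ((x1 - x01) * al * al) * ((be*y1 - Q1) * be)
        + (1/2 : ℝ) * ((al*x1 - P1) * al) * ((be*y0 - Q0) * (be*y1 - Q1))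
        + (1/2 : ℝ) * ((al*x0 - P0) * (al*x1 - P1)) * ((be*y1 - Q1) * be)
        + (1/2 : ℝ) * ((al*x1 - P1) * al) * (Q1 * (Q1 - Q01))
        + (1/2 : ℝ) * (P1 * (P1 - P01)) * ((be*y1 - Q1) * be)
        + (1/2 : ℝ) * ((al*x1 - P1) * al) * ((Q1 - Q01) * (be - Q0 - Q1 + Q01))
        + (1/2 : ℝ) * ((P1 - P01) * (al - P0 - P1 + P01)) * ((be*y1 - Q1) * be)
        + (1/2 : ℝ) * (((al*x0 - P0) + (al*x1 - P1) - (al*x01 - P01)) * al) * ((be*y0 - Q0) * Q1)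
        + (1/2 : ℝ) * ((al*x0 - P0) * P1) * (((be*y0 - Q0) + (be*y1 - Q1) - (be*y01 - Q01)) * be)
        + (1/2 : ℝ) * (((al*x0 - P0) + (al*x1 - P1) - (al*x01 - P01)) * al) * ((be*y1 - Q1) * Q0)
        + (1/2 : ℝ) * ((al*x1 - P1) * P0) * (((be*y0 - Q0) + (be*y1 - Q1) - (be*y01 - Q01)) * be)
        + (1 : ℝ) * (((al*x0 - P0) + (al*x1 - P1) - (al*x01 - P01)) * al) * ((Q0 - Q01) * (Q1 - Q01))
        + (1 : ℝ) * ((P0 - P01) * (P1 - P01)) * (((be*y0 - Q0) + (be*y1 - Q1) - (be*y01 - Q01)) * be)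
        + (1/2 : ℝ) * (P01 * al) * ((be*(y0 + y1 - y01 + y0*y1) - Q0*(1 + y1) - Q1*(1 + y0) + 2*Q01) * be)
        + (1/2 : ℝ) * ((al*(x0 + x1 - x01 + x0*x1) - P0*(1 + x1) - P1*(1 + x0) + 2*P01) * al) * (Q01 * be)
        + (1/2 : ℝ) * ((x01 - x0*x1) * al * al) * ((be*y0 - Q0) * (y0 - y01) * be)
        + (1/2 : ℝ) * ((al*x0 - P0) * (x0 - x01) * al) * ((y01 - y0*y1) * be * be)
        + (1/2 : ℝ) * ((x01 - x0*x1) * al * al) * (((be*y0 - Q0) + (be*y1 - Q1) - (be*y01 - Q01)) * Q01)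
        + (1/2 : ℝ) * (((al*x0 - P0) + (al*x1 - P1) - (al*x01 - P01)) * P01) * ((y01 - y0*y1) * be * be)
        + (1/2 : ℝ) * ((x01 - x0*x1) * al * al) * (((be*y0 - Q0) + (be*y1 - Q1) - (be*y01 - Q01)) * (1 - y0) * be)
        + (1/2 : ℝ) * (((al*x0 - P0) + (al*x1 - P1) - (al*x01 - P01)) * (1 - x0) * al) * ((y01 - y0*y1) * be * be)
        + (1/2 : ℝ) * ((x01 - x0*x1) * al * al) * ((y1 - y01) * (Q0 - Q01) * be)
        + (1/2 : ℝ) * ((x1 - x01) * (P0 - P01) * al) * ((y01 - y0*y1) * be * be)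
        + (1/2 : ℝ) * ((al*(x0 + x1 - x01 + x0*x1) - P0*(1 + x1) - P1*(1 + x0) + 2*P01) * al) * (Q0 * Q01)
        + (1/2 : ℝ) * (P0 * P01) * ((be*(y0 + y1 - y01 + y0*y1) - Q0*(1 + y1) - Q1*(1 + y0) + 2*Q01) * be)
        + (1/2 : ℝ) * ((al*(x0 + x1 - x01 + x0*x1) - P0*(1 + x1) - P1*(1 + x0) + 2*P01) * al) * (Q01 * (Q1 - Q01))
        + (1/2 : ℝ) * (P01 * (P1 - P01)) * ((be*(y0 + y1 - y01 + y0*y1) - Q0*(1 + y1) - Q1*(1 + y0) + 2*Q01) * be)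
        + (1/2 : ℝ) * ((al*x0 - P0) * P1) * ((be*y1 - Q1) * y0 * be)
        + (1/2 : ℝ) * ((al*x1 - P1) * x0 * al) * ((be*y0 - Q0) * Q1)
        + (1/2 : ℝ) * ((al*x0 - P0) * x1 * al) * ((be*y1 - Q1) * Q0)
        + (1/2 : ℝ) * ((al*x1 - P1) * P0) * ((be*y0 - Q0) * y1 * be)
        + (1/2 : ℝ) * ((al*x0 - P0) * x1 * al) * ((Q0 - Q01) * (Q1 - Q01))
        + (1/2 : ℝ) * ((P0 - P01) * (P1 - P01)) * ((be*y0 - Q0) * y1 * be)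
        + (1/2 : ℝ) * ((al*x1 - P1) * x0 * al) * ((Q0 - Q01) * (Q1 - Q01))
        + (1/2 : ℝ) * ((P0 - P01) * (P1 - P01)) * ((be*y1 - Q1) * y0 * be) := by
    ring
  have p0 : 0 ≤ (1/2 : ℝ) * ((al*x0 - P0) * al) * ((y0 - y01) * be * be) :=
    mul_nonneg (mul_nonneg (by norm_num) (mul_nonneg hK0 hal)) (mul_nonneg (mul_nonneg (sub_nonneg.2 hy01a) hbe) hbe)
  have p1 : 0 ≤ (1/2 : ℝ) * ((x0 - x01) * al * al) * ((be*y0 - Q0) * be) :=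
    mul_nonneg (mul_nonneg (by norm_num) (mul_nonneg (mul_nonneg (sub_nonneg.2 hx01a) hal) hal)) (mul_nonneg hL0 hbe)
  have p2 : 0 ≤ (1/2 : ℝ) * ((al*x0 - P0) * al) * ((be*y0 - Q0) * (be*y1 - Q1)) :=
    mul_nonneg (mul_nonneg (by norm_num) (mul_nonneg hK0 hal)) (mul_nonneg hL0 hL1)
  have p3 : 0 ≤ (1/2 : ℝ) * ((al*x0 - P0) * (al*x1 - P1)) * ((be*y0 - Q0) * be) :=
    mul_nonneg (mul_nonneg (by norm_num) (mul_nonneg hK0 hK1)) (mul_nonneg hL0 hbe)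
  have p4 : 0 ≤ (1/2 : ℝ) * ((al*x0 - P0) * al) * (Q0 * (Q0 - Q01)) :=
    mul_nonneg (mul_nonneg (by norm_num) (mul_nonneg hK0 hal)) (mul_nonneg hQ0 (sub_nonneg.2 hQ01a))
  have p5 : 0 ≤ (1/2 : ℝ) * (P0 * (P0 - P01)) * ((be*y0 - Q0) * be) :=
    mul_nonneg (mul_nonneg (by norm_num) (mul_nonneg hP0 (sub_nonneg.2 hP01a))) (mul_nonneg hL0 hbe)
  have p6 : 0 ≤ (1/2 : ℝ) * ((al*x0 - P0) * al) * ((Q0 - Q01) * (be - Q0 - Q1 + Q01)) :=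
    mul_nonneg (mul_nonneg (by norm_num) (mul_nonneg hK0 hal)) (mul_nonneg (sub_nonneg.2 hQ01a) hU)
  have p7 : 0 ≤ (1/2 : ℝ) * ((P0 - P01) * (al - P0 - P1 + P01)) * ((be*y0 - Q0) * be) :=
    mul_nonneg (mul_nonneg (by norm_num) (mul_nonneg (sub_nonneg.2 hP01a) hT)) (mul_nonneg hL0 hbe)
  have p8 : 0 ≤ (1/2 : ℝ) * ((al*x1 - P1) * al) * ((y1 - y01) * be * be) :=
    mul_nonneg (mul_nonneg (by norm_num) (mul_nonneg hK1 hal)) (mul_nonneg (mul_nonneg (sub_nonneg.2 hy01b) hbe) hbe)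
  have p9 : 0 ≤ (1/2 : ℝ) * ((x1 - x01) * al * al) * ((be*y1 - Q1) * be) :=
    mul_nonneg (mul_nonneg (by norm_num) (mul_nonneg (mul_nonneg (sub_nonneg.2 hx01b) hal) hal)) (mul_nonneg hL1 hbe)
  have p10 : 0 ≤ (1/2 : ℝ) * ((al*x1 - P1) * al) * ((be*y0 - Q0) * (be*y1 - Q1)) :=
    mul_nonneg (mul_nonneg (by norm_num) (mul_nonneg hK1 hal)) (mul_nonneg hL0 hL1)
  have p11 : 0 ≤ (1/2 : ℝ) * ((al*x0 - P0) * (al*x1 - P1)) * ((be*y1 - Q1) * be) :=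
    mul_nonneg (mul_nonneg (by norm_num) (mul_nonneg hK0 hK1)) (mul_nonneg hL1 hbe)
  have p12 : 0 ≤ (1/2 : ℝ) * ((al*x1 - P1) * al) * (Q1 * (Q1 - Q01)) :=
    mul_nonneg (mul_nonneg (by norm_num) (mul_nonneg hK1 hal)) (mul_nonneg hQ1 (sub_nonneg.2 hQ01b))
  have p13 : 0 ≤ (1/2 : ℝ) * (P1 * (P1 - P01)) * ((be*y1 - Q1) * be) :=
    mul_nonneg (mul_nonneg (by norm_num) (mul_nonneg hP1 (sub_nonneg.2 hP01b))) (mul_nonneg hL1 hbe)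
  have p14 : 0 ≤ (1/2 : ℝ) * ((al*x1 - P1) * al) * ((Q1 - Q01) * (be - Q0 - Q1 + Q01)) :=
    mul_nonneg (mul_nonneg (by norm_num) (mul_nonneg hK1 hal)) (mul_nonneg (sub_nonneg.2 hQ01b) hU)
  have p15 : 0 ≤ (1/2 : ℝ) * ((P1 - P01) * (al - P0 - P1 + P01)) * ((be*y1 - Q1) * be) :=
    mul_nonneg (mul_nonneg (by norm_num) (mul_nonneg (sub_nonneg.2 hP01b) hT)) (mul_nonneg hL1 hbe)
  have p16 : 0 ≤ (1/2 : ℝ) * (((al*x0 - P0) + (al*x1 - P1) - (al*x01 - P01)) * al) * ((be*y0 - Q0) * Q1) :=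
    mul_nonneg (mul_nonneg (by norm_num) (mul_nonneg hR hal)) (mul_nonneg hL0 hQ1)
  have p17 : 0 ≤ (1/2 : ℝ) * ((al*x0 - P0) * P1) * (((be*y0 - Q0) + (be*y1 - Q1) - (be*y01 - Q01)) * be) :=
    mul_nonneg (mul_nonneg (by norm_num) (mul_nonneg hK0 hP1)) (mul_nonneg hS hbe)
  have p18 : 0 ≤ (1/2 : ℝ) * (((al*x0 - P0) + (al*x1 - P1) - (al*x01 - P01)) * al) * ((be*y1 - Q1) * Q0) :=
    mul_nonneg (mul_nonneg (by norm_num) (mul_nonneg hR hal)) (mul_nonneg hL1 hQ0)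
  have p19 : 0 ≤ (1/2 : ℝ) * ((al*x1 - P1) * P0) * (((be*y0 - Q0) + (be*y1 - Q1) - (be*y01 - Q01)) * be) :=
    mul_nonneg (mul_nonneg (by norm_num) (mul_nonneg hK1 hP0)) (mul_nonneg hS hbe)
  have p20 : 0 ≤ (1 : ℝ) * (((al*x0 - P0) + (al*x1 - P1) - (al*x01 - P01)) * al) * ((Q0 - Q01) * (Q1 - Q01)) :=
    mul_nonneg (mul_nonneg (by norm_num) (mul_nonneg hR hal)) (mul_nonneg (sub_nonneg.2 hQ01a) (sub_nonneg.2 hQ01b))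
  have p21 : 0 ≤ (1 : ℝ) * ((P0 - P01) * (P1 - P01)) * (((be*y0 - Q0) + (be*y1 - Q1) - (be*y01 - Q01)) * be) :=
    mul_nonneg (mul_nonneg (by norm_num) (mul_nonneg (sub_nonneg.2 hP01a) (sub_nonneg.2 hP01b))) (mul_nonneg hS hbe)
  have p22 : 0 ≤ (1/2 : ℝ) * (P01 * al) * ((be*(y0 + y1 - y01 + y0*y1) - Q0*(1 + y1) - Q1*(1 + y0) + 2*Q01) * be) :=
    mul_nonneg (mul_nonneg (by norm_num) (mul_nonneg hP01 hal)) (mul_nonneg hf hbe)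
  have p23 : 0 ≤ (1/2 : ℝ) * ((al*(x0 + x1 - x01 + x0*x1) - P0*(1 + x1) - P1*(1 + x0) + 2*P01) * al) * (Q01 * be) :=
    mul_nonneg (mul_nonneg (by norm_num) (mul_nonneg he hal)) (mul_nonneg hQ01 hbe)
  have p24 : 0 ≤ (1/2 : ℝ) * ((x01 - x0*x1) * al * al) * ((be*y0 - Q0) * (y0 - y01) * be) :=
    mul_nonneg (mul_nonneg (by norm_num) (mul_nonneg (mul_nonneg (sub_nonneg.2 hk) hal) hal)) (mul_nonneg (mul_nonneg hL0 (sub_nonneg.2 hy01a)) hbe)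
  have p25 : 0 ≤ (1/2 : ℝ) * ((al*x0 - P0) * (x0 - x01) * al) * ((y01 - y0*y1) * be * be) :=
    mul_nonneg (mul_nonneg (by norm_num) (mul_nonneg (mul_nonneg hK0 (sub_nonneg.2 hx01a)) hal)) (mul_nonneg (mul_nonneg (sub_nonneg.2 hl) hbe) hbe)
  have p26 : 0 ≤ (1/2 : ℝ) * ((x01 - x0*x1) * al * al) * (((be*y0 - Q0) + (be*y1 - Q1) - (be*y01 - Q01)) * Q01) :=
    mul_nonneg (mul_nonneg (by norm_num) (mul_nonneg (mul_nonneg (sub_nonneg.2 hk) hal) hal)) (mul_nonneg hS hQ01)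
  have p27 : 0 ≤ (1/2 : ℝ) * (((al*x0 - P0) + (al*x1 - P1) - (al*x01 - P01)) * P01) * ((y01 - y0*y1) * be * be) :=
    mul_nonneg (mul_nonneg (by norm_num) (mul_nonneg hR hP01)) (mul_nonneg (mul_nonneg (sub_nonneg.2 hl) hbe) hbe)
  have p28 : 0 ≤ (1/2 : ℝ) * ((x01 - x0*x1) * al * al) * (((be*y0 - Q0) + (be*y1 - Q1) - (be*y01 - Q01)) * (1 - y0) * be) :=
    mul_nonneg (mul_nonneg (by norm_num) (mul_nonneg (mul_nonneg (sub_nonneg.2 hk) hal) hal)) (mul_nonneg (mul_nonneg hS (sub_nonneg.2 hy0')) hbe)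
  have p29 : 0 ≤ (1/2 : ℝ) * (((al*x0 - P0) + (al*x1 - P1) - (al*x01 - P01)) * (1 - x0) * al) * ((y01 - y0*y1) * be * be) :=
    mul_nonneg (mul_nonneg (by norm_num) (mul_nonneg (mul_nonneg hR (sub_nonneg.2 hx0')) hal)) (mul_nonneg (mul_nonneg (sub_nonneg.2 hl) hbe) hbe)
  have p30 : 0 ≤ (1/2 : ℝ) * ((x01 - x0*x1) * al * al) * ((y1 - y01) * (Q0 - Q01) * be) :=
    mul_nonneg (mul_nonneg (by norm_num) (mul_nonneg (mul_nonneg (sub_nonneg.2 hk) hal) hal)) (mul_nonneg (mul_nonneg (sub_nonneg.2 hy01b) (sub_nonneg.2 hQ01a)) hbe)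
  have p31 : 0 ≤ (1/2 : ℝ) * ((x1 - x01) * (P0 - P01) * al) * ((y01 - y0*y1) * be * be) :=
    mul_nonneg (mul_nonneg (by norm_num) (mul_nonneg (mul_nonneg (sub_nonneg.2 hx01b) (sub_nonneg.2 hP01a)) hal)) (mul_nonneg (mul_nonneg (sub_nonneg.2 hl) hbe) hbe)
  have p32 : 0 ≤ (1/2 : ℝ) * ((al*(x0 + x1 - x01 + x0*x1) - P0*(1 + x1) - P1*(1 + x0) + 2*P01) * al) * (Q0 * Q01) :=
    mul_nonneg (mul_nonneg (by norm_num) (mul_nonneg he hal)) (mul_nonneg hQ0 hQ01)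
  have p33 : 0 ≤ (1/2 : ℝ) * (P0 * P01) * ((be*(y0 + y1 - y01 + y0*y1) - Q0*(1 + y1) - Q1*(1 + y0) + 2*Q01) * be) :=
    mul_nonneg (mul_nonneg (by norm_num) (mul_nonneg hP0 hP01)) (mul_nonneg hf hbe)
  have p34 : 0 ≤ (1/2 : ℝ) * ((al*(x0 + x1 - x01 + x0*x1) - P0*(1 + x1) - P1*(1 + x0) + 2*P01) * al) * (Q01 * (Q1 - Q01)) :=
    mul_nonneg (mul_nonneg (by norm_num) (mul_nonneg he hal)) (mul_nonneg hQ01 (sub_nonneg.2 hQ01b))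
  have p35 : 0 ≤ (1/2 : ℝ) * (P01 * (P1 - P01)) * ((be*(y0 + y1 - y01 + y0*y1) - Q0*(1 + y1) - Q1*(1 + y0) + 2*Q01) * be) :=
    mul_nonneg (mul_nonneg (by norm_num) (mul_nonneg hP01 (sub_nonneg.2 hP01b))) (mul_nonneg hf hbe)
  have p36 : 0 ≤ (1/2 : ℝ) * ((al*x0 - P0) * P1) * ((be*y1 - Q1) * y0 * be) :=
    mul_nonneg (mul_nonneg (by norm_num) (mul_nonneg hK0 hP1)) (mul_nonneg (mul_nonneg hL1 hy0) hbe)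
  have p37 : 0 ≤ (1/2 : ℝ) * ((al*x1 - P1) * x0 * al) * ((be*y0 - Q0) * Q1) :=
    mul_nonneg (mul_nonneg (by norm_num) (mul_nonneg (mul_nonneg hK1 hx0) hal)) (mul_nonneg hL0 hQ1)
  have p38 : 0 ≤ (1/2 : ℝ) * ((al*x0 - P0) * x1 * al) * ((be*y1 - Q1) * Q0) :=
    mul_nonneg (mul_nonneg (by norm_num) (mul_nonneg (mul_nonneg hK0 hx1) hal)) (mul_nonneg hL1 hQ0)
  have p39 : 0 ≤ (1/2 : ℝ) * ((al*x1 - P1) * P0) * ((be*y0 - Q0) * y1 * be) :=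
    mul_nonneg (mul_nonneg (by norm_num) (mul_nonneg hK1 hP0)) (mul_nonneg (mul_nonneg hL0 hy1) hbe)
  have p40 : 0 ≤ (1/2 : ℝ) * ((al*x0 - P0) * x1 * al) * ((Q0 - Q01) * (Q1 - Q01)) :=
    mul_nonneg (mul_nonneg (by norm_num) (mul_nonneg (mul_nonneg hK0 hx1) hal)) (mul_nonneg (sub_nonneg.2 hQ01a) (sub_nonneg.2 hQ01b))
  have p41 : 0 ≤ (1/2 : ℝ) * ((P0 - P01) * (P1 - P01)) * ((be*y0 - Q0) * y1 * be) :=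
    mul_nonneg (mul_nonneg (by norm_num) (mul_nonneg (sub_nonneg.2 hP01a) (sub_nonneg.2 hP01b))) (mul_nonneg (mul_nonneg hL0 hy1) hbe)
  have p42 : 0 ≤ (1/2 : ℝ) * ((al*x1 - P1) * x0 * al) * ((Q0 - Q01) * (Q1 - Q01)) :=
    mul_nonneg (mul_nonneg (by norm_num) (mul_nonneg (mul_nonneg hK1 hx0) hal)) (mul_nonneg (sub_nonneg.2 hQ01a) (sub_nonneg.2 hQ01b))
  have p43 : 0 ≤ (1/2 : ℝ) * ((P0 - P01) * (P1 - P01)) * ((be*y1 - Q1) * y0 * be) :=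
    mul_nonneg (mul_nonneg (by norm_num) (mul_nonneg (sub_nonneg.2 hP01a) (sub_nonneg.2 hP01b))) (mul_nonneg (mul_nonneg hL1 hy0) hbe)
  have hprod : 0 ≤ al * be * (2 * (al*be - P0*Q0 - P1*Q1 + P01*Q01) + (1 - x0*y0) * (1 - x1*y1) * (al*be) - ((1 - x0*y0) * (al*be - P1*Q1) + (1 - x1*y1) * (al*be - P0*Q0) + (al*be) * (1 - x0*y0 - x1*y1 + x01*y01))) := by
    rw [key]
    exact (add_nonneg (add_nonneg (add_nonneg (add_nonneg (add_nonneg (add_nonneg (add_nonneg (add_nonneg (add_nonneg (add_nonneg (add_nonneg (add_nonneg (add_nonneg (add_nonneg (add_nonneg (add_nonneg (add_nonneg (add_nonneg (add_nonneg (add_nonneg (add_nonneg (add_nonneg (add_nonneg (add_nonneg (add_nonneg (add_nonneg (add_nonneg (add_nonneg (add_nonneg (add_nonneg (add_nonneg (add_nonneg (add_nonneg (add_nonneg (add_nonneg (add_nonneg (add_nonneg (add_nonneg (add_nonneg (add_nonneg (add_nonneg (add_nonneg (add_nonneg p0 p1) p2) p3) p4) p5) p6) p7) p8) p9) p10) p11)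 p12) p13) p14) p15) p16) p17) p18) p19) p20) p21) p22) p23) p24) p25) p26) p27) p28) p29) p30) p31) p32) p33) p34) p35) p36) p37) p38) p39) p40) p41) p42) p43)
  rcases (mul_nonneg hal hbe).eq_or_lt with h | h
  · -- degenerate: `αβ = 0`; then the `P`'s (or `Q`'s) vanish and `E₃(u) = 0`
    rcases mul_eq_zero.1 h.symm with h0 | h0
    · have e0 : P0 = 0 := by rw [h0, zero_mul] at hK0; linarith only [hK0, hP0]
      have e1 : P1 = 0 := by rw [h0, zero_mul] at hK1; linarith only [hK1, hP1]
      have e01 : P01 = 0 := by linarith only [hP01, hP01a, e0]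
      rw [h0, e0, e1, e01]
      exact le_of_eq (by ring)
    · have e0 : Q0 = 0 := by rw [h0, zero_mul] at hL0; linarith only [hL0, hQ0]
      have e1 : Q1 = 0 := by rw [h0, zero_mul] at hL1; linarith only [hL1, hQ1]
      have e01 : Q01 = 0 := by linarith only [hQ01, hQ01a, e0]
      rw [h0, e0, e1, e01]
      exact le_of_eq (by ring)
  · exact le_of_mul_le_mul_left (by rw [mul_zero]; exact hprod) h

/-- **One-sided dictionary for the mixed triple (OR, OR, AND)**: for `[0,1]`-valued `a_0,a_1,a_2` under a probability weight `μ`, the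
coordinates `x_0 = E(1−a_0)`, `x_1`, `x_01 = E(1−a_0)(1−a_1)`, `α = Ea_2`, `P_0 = E(1−a_0)a_2`, `P_1`, `P_01 = E(1−a_0)(1−a_1)a_2` (passed as reals with
their defining equations) satisfy the seventeen hypotheses of `e3MixedOOA_nonneg`, given the Harris rows `Cov(a_0,a_1), Cov(a_0,a_2), Cov(a_1,a_2) ≥ 0`,
the hereditary row `Cov(a_0a_1,a_2) ≥ 0` and Sahi's row `E₃(a) ≥ 0`. [this work] -/
theorem mixedMoments_facts {γ : Type*} [Fintype γ] (μ : γ → ℝ) (hμ0 : ∀ t, 0 ≤ μ t) (hμ1 : ∑ t, μ t = 1)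
    (a : Fin 3 → γ → ℝ) (ha0 : ∀ i t, 0 ≤ a i t) (ha1 : ∀ i t, a i t ≤ 1)
    (hκ01 : ex μ (a 0) * ex μ (a 1) ≤ ex μ (a 0 * a 1)) (hκ02 : ex μ (a 0) * ex μ (a 2) ≤ ex μ (a 0 * a 2)) (hκ12 : ex μ (a 1) * ex μ (a 2) ≤ ex μ (a 1 * a 2))
    (hρ2 : ex μ (a 0 * a 1) * ex μ (a 2) ≤ ex μ (a 0 * a 1 * a 2)) (he : 0 ≤ sahiE μ 3 a)
    (x0 x1 x01 al P0 P1 P01 : ℝ)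
    (dx0 : x0 = ex μ (fun t => (1 - a 0 t)))
    (dx1 : x1 = ex μ (fun t => (1 - a 1 t)))
    (dx01 : x01 = ex μ (fun t => (1 - a 0 t) * (1 - a 1 t)))
    (dal : al = ex μ (a 2))
    (dP0 : P0 = ex μ (fun t => (1 - a 0 t) * a 2 t))
    (dP1 : P1 = ex μ (fun t => (1 - a 1 t) * a 2 t))
    (dP01 : P01 = ex μ (fun t => (1 - a 0 t) * (1 - a 1 t) * a 2 t)) :
    (0 ≤ x0) ∧
      (0 ≤ x1) ∧
      (x0 ≤ 1) ∧
      (x01 ≤ x0) ∧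
      (x01 ≤ x1) ∧
      (0 ≤ al) ∧
      (0 ≤ P0) ∧
      (0 ≤ P1) ∧
      (0 ≤ P01) ∧
      (P01 ≤ P0) ∧
      (P01 ≤ P1) ∧
      (0 ≤ al - P0 - P1 + P01) ∧
      (0 ≤ al*x0 - P0) ∧
      (0 ≤ al*x1 - P1) ∧
      (0 ≤ (al*x0 - P0) + (al*x1 - P1) - (al*x01 - P01)) ∧
      (x0*x1 ≤ x01) ∧
      (0 ≤ al*(x0 + x1 - x01 + x0*x1) - P0*(1 + x1) - P1*(1 + x0) + 2*P01) := by
  subst dx0 dx1 dx01 dal dP0 dP1 dP01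
  have p0 : ∀ t, 0 ≤ 1 - a 0 t := fun t => sub_nonneg.2 (ha1 0 t)
  have p1 : ∀ t, 0 ≤ 1 - a 1 t := fun t => sub_nonneg.2 (ha1 1 t)
  have q0 : ∀ t, 1 - a 0 t ≤ 1 := fun t => sub_le_self _ (ha0 0 t)
  have q1 : ∀ t, 1 - a 1 t ≤ 1 := fun t => sub_le_self _ (ha0 1 t)
  have i0 : ex μ (fun t => (1 - a 0 t)) = 1 - ex μ (a 0) := by
    rw [ex_sub', ex_const hμ1]
  have i1 : ex μ (fun t => (1 - a 1 t)) = 1 - ex μ (a 1) := by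
    rw [ex_sub', ex_const hμ1]
  have i01 : ex μ (fun t => (1 - a 0 t) * (1 - a 1 t)) = 1 - ex μ (a 0) - ex μ (a 1) + ex μ (a 0 * a 1) := by
    rw [show (fun t => (1 - a 0 t) * (1 - a 1 t)) = fun t => (fun _ => (1:ℝ)) t - a 0 t - a 1 t + (a 0 * a 1) t from
      funext fun t => by simp only [Pi.mul_apply]; ring]
    rw [ex_add', ex_sub', ex_sub', ex_const hμ1]
  have iP0 : ex μ (fun t => (1 - a 0 t) * a 2 t) = ex μ (a 2) - ex μ (a 0 * a 2) := by
    rw [show (fun t => (1 - a 0 t) * a 2 t) = fun t => a 2 t - (a 0 * a 2) t from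
      funext fun t => by simp only [Pi.mul_apply]; ring]
    rw [ex_sub']
  have iP1 : ex μ (fun t => (1 - a 1 t) * a 2 t) = ex μ (a 2) - ex μ (a 1 * a 2) := by
    rw [show (fun t => (1 - a 1 t) * a 2 t) = fun t => a 2 t - (a 1 * a 2) t from
      funext fun t => by simp only [Pi.mul_apply]; ring]
    rw [ex_sub']
  have iP01 : ex μ (fun t => (1 - a 0 t) * (1 - a 1 t) * a 2 t) = ex μ (a 2) - ex μ (a 0 * a 2) - ex μ (a 1 * a 2) + ex μ (a 0 * a 1 * a 2) := by
    rw [show (fun t => (1 - a 0 t) * (1 - a 1 t) * a 2 t) = fun t => a 2 t - (a 0 * a 2) t - (a 1 * a 2) t + (a 0 * a 1 * a 2) t from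
      funext fun t => by simp only [Pi.mul_apply]; ring]
    rw [ex_add', ex_sub', ex_sub']
  have he' := he
  rw [sahiE_three_apply] at he'
  have hE0 : 0 ≤ ex μ (a 0) := ex_nonneg hμ0 (ha0 0)
  have hE1 : 0 ≤ ex μ (a 1) := ex_nonneg hμ0 (ha0 1)
  have hE012 : 0 ≤ ex μ (a 0 * a 1 * a 2) := ex_nonneg hμ0 fun t => mul_nonneg (mul_nonneg (ha0 0 t) (ha0 1 t)) (ha0 2 t)
  refine ⟨ex_nonneg hμ0 p0, ex_nonneg hμ0 p1, by linarith only [i0, hE0],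
    ex_mono hμ0 (fun t => mul_le_of_le_one_right (p0 t) (q1 t)), ex_mono hμ0 (fun t => mul_le_of_le_one_left (p1 t) (q0 t)),
    ex_nonneg hμ0 (ha0 2),
    ex_nonneg hμ0 (fun t => mul_nonneg (p0 t) (ha0 2 t)), ex_nonneg hμ0 (fun t => mul_nonneg (p1 t) (ha0 2 t)),
    ex_nonneg hμ0 (fun t => mul_nonneg (mul_nonneg (p0 t) (p1 t)) (ha0 2 t)),
    ex_mono hμ0 (fun t => ?_), ex_mono hμ0 (fun t => ?_), ?_, ?_, ?_, ?_, ?_, ?_⟩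
  · -- (1-a0)(1-a1)a2 ≤ (1-a0)a2
    have h := mul_le_of_le_one_right (mul_nonneg (p0 t) (ha0 2 t)) (q1 t)
    nlinarith only [h]
  · -- (1-a0)(1-a1)a2 ≤ (1-a1)a2
    have h := mul_le_of_le_one_right (mul_nonneg (p1 t) (ha0 2 t)) (q0 t)
    nlinarith only [h]
  · rw [iP0, iP1, iP01]; linarith only [hE012]
  · rw [i0, iP0]; nlinarith only [hκ02]
  · rw [i1, iP1]; nlinarith only [hκ12]
  · rw [i0, i1, i01, iP0, iP1, iP01]; nlinarith only [hρ2]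
  · rw [i0, i1, i01]; nlinarith only [hκ01]
  · rw [i0, i1, i01, iP0, iP1, iP01]; nlinarith only [he']

/-- **`E₃ ≥ 0` for the MIXED separable triple (OR, OR, AND)** — measure level.  `μ`, `ν` probability weights on finite types; `a_i : γ → [0,1]`,
`b_i : β → [0,1]`; on each side the Harris rows `Cov(·,·) ≥ 0` for the three pairs, the hereditary row `Cov(a_0a_1, a_2) ≥ 0` (product of the two
OR-members against the AND-member) and Sahi's row `E₃ ≥ 0`.  Then under `μ ⊗ ν` the slots `u_0 = a_0 ⊕ b_0 − a_0b_0`, `u_1 = a_1 ⊕ b_1 − a_1b_1`,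
`u_2 = a_2 ⊗ b_2` (indicators of `A_0×β ∪ γ×B_0`, `A_1×β ∪ γ×B_1`, `A_2 × B_2`) have `E₃(u_0,u_1,u_2) ≥ 0`.  By the symmetry of `E₃` the AND member may sit in
any slot. [this work] -/
theorem sahiE_three_ooa_nonneg {γ β : Type*} [Fintype γ] [Fintype β] (μ : γ → ℝ) (ν : β → ℝ)
    (hμ0 : ∀ t, 0 ≤ μ t) (hμ1 : ∑ t, μ t = 1) (hν0 : ∀ t, 0 ≤ ν t) (hν1 : ∑ t, ν t = 1)
    (a : Fin 3 → γ → ℝ) (b : Fin 3 → β → ℝ) (ha0 : ∀ i t, 0 ≤ a i t) (ha1 : ∀ i t, a i t ≤ 1) (hb0 : ∀ i t, 0 ≤ b i t) (hb1 : ∀ i t, b i t ≤ 1)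
    (hκ01 : ex μ (a 0) * ex μ (a 1) ≤ ex μ (a 0 * a 1)) (hκ02 : ex μ (a 0) * ex μ (a 2) ≤ ex μ (a 0 * a 2))
    (hκ12 : ex μ (a 1) * ex μ (a 2) ≤ ex μ (a 1 * a 2)) (hρ2 : ex μ (a 0 * a 1) * ex μ (a 2) ≤ ex μ (a 0 * a 1 * a 2)) (hea : 0 ≤ sahiE μ 3 a)
    (hL01 : ex ν (b 0) * ex ν (b 1) ≤ ex ν (b 0 * b 1)) (hL02 : ex ν (b 0) * ex ν (b 2) ≤ ex ν (b 0 * b 2))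
    (hL12 : ex ν (b 1) * ex ν (b 2) ≤ ex ν (b 1 * b 2)) (hσ2 : ex ν (b 0 * b 1) * ex ν (b 2) ≤ ex ν (b 0 * b 1 * b 2)) (heb : 0 ≤ sahiE ν 3 b) :
    0 ≤ sahiE (fun p : γ × β => μ p.1 * ν p.2) 3 ![(fun p : γ × β => a 0 p.1 + b 0 p.2 - a 0 p.1 * b 0 p.2),
      (fun p : γ × β => a 1 p.1 + b 1 p.2 - a 1 p.1 * b 1 p.2), (fun p : γ × β => a 2 p.1 * b 2 p.2)] := by
  obtain ⟨hx0, hx1, hx0', hx01a, hx01b, hal, hP0, hP1, hP01, hP01a, hP01b, hT, hK0, hK1, hR, hk, heA⟩ :=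
    mixedMoments_facts μ hμ0 hμ1 a ha0 ha1 hκ01 hκ02 hκ12 hρ2 hea _ _ _ _ _ _ _ rfl rfl rfl rfl rfl rfl rfl
  obtain ⟨hy0, hy1, hy0', hy01a, hy01b, hbe, hQ0, hQ1, hQ01, hQ01a, hQ01b, hU, hL0, hL1, hS, hl, hfB⟩ :=
    mixedMoments_facts ν hν0 hν1 b hb0 hb1 hL01 hL02 hL12 hσ2 heb _ _ _ _ _ _ _ rfl rfl rfl rfl rfl rfl rfl
  have hW1 : ∑ p : γ × β, (fun p : γ × β => μ p.1 * ν p.2) p = 1 := sum_prodWeight μ ν hμ1 hν1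
  have g0 : ex (fun p : γ × β => μ p.1 * ν p.2) (fun p : γ × β => (1 - a 0 p.1) * (1 - b 0 p.2)) = ex μ (fun t => (1 - a 0 t)) * ex ν (fun t => (1 - b 0 t)) :=
    ex_tensor μ ν (fun t => (1 - a 0 t)) (fun t => (1 - b 0 t)) _ fun p => rfl
  have g1 : ex (fun p : γ × β => μ p.1 * ν p.2) (fun p : γ × β => (1 - a 1 p.1) * (1 - b 1 p.2)) = ex μ (fun t => (1 - a 1 t)) * ex ν (fun t => (1 - b 1 t)) :=
    ex_tensor μ ν (fun t => (1 - a 1 t)) (fun t => (1 - b 1 t)) _ fun p => rfl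
  have g01 : ex (fun p : γ × β => μ p.1 * ν p.2) (fun p : γ × β => ((1 - a 0 p.1) * (1 - a 1 p.1)) * ((1 - b 0 p.2) * (1 - b 1 p.2))) = ex μ (fun t => (1 - a 0 t) * (1 - a 1 t)) * ex ν (fun t => (1 - b 0 t) * (1 - b 1 t)) :=
    ex_tensor μ ν (fun t => (1 - a 0 t) * (1 - a 1 t)) (fun t => (1 - b 0 t) * (1 - b 1 t)) _ fun p => rfl
  have g2 : ex (fun p : γ × β => μ p.1 * ν p.2) (fun p : γ × β => a 2 p.1 * b 2 p.2) = ex μ (a 2) * ex ν (b 2) := ex_tensor μ ν (a 2) (b 2) _ fun p => rfl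
  have g02 : ex (fun p : γ × β => μ p.1 * ν p.2) (fun p : γ × β => ((1 - a 0 p.1) * a 2 p.1) * ((1 - b 0 p.2) * b 2 p.2)) = ex μ (fun t => (1 - a 0 t) * a 2 t) * ex ν (fun t => (1 - b 0 t) * b 2 t) :=
    ex_tensor μ ν (fun t => (1 - a 0 t) * a 2 t) (fun t => (1 - b 0 t) * b 2 t) _ fun p => rfl
  have g12 : ex (fun p : γ × β => μ p.1 * ν p.2) (fun p : γ × β => ((1 - a 1 p.1) * a 2 p.1) * ((1 - b 1 p.2) * b 2 p.2)) = ex μ (fun t => (1 - a 1 t) * a 2 t) * ex ν (fun t => (1 - b 1 t) * b 2 t) :=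
    ex_tensor μ ν (fun t => (1 - a 1 t) * a 2 t) (fun t => (1 - b 1 t) * b 2 t) _ fun p => rfl
  have g012 : ex (fun p : γ × β => μ p.1 * ν p.2) (fun p : γ × β => ((1 - a 0 p.1) * (1 - a 1 p.1) * a 2 p.1) * ((1 - b 0 p.2) * (1 - b 1 p.2) * b 2 p.2)) = ex μ (fun t => (1 - a 0 t) * (1 - a 1 t) * a 2 t) * ex ν (fun t => (1 - b 0 t) * (1 - b 1 t) * b 2 t) :=
    ex_tensor μ ν (fun t => (1 - a 0 t) * (1 - a 1 t) * a 2 t) (fun t => (1 - b 0 t) * (1 - b 1 t) * b 2 t) _ fun p => rfl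
  have m0 : ex (fun p : γ × β => μ p.1 * ν p.2) (fun p : γ × β => a 0 p.1 + b 0 p.2 - a 0 p.1 * b 0 p.2) = 1 - ex μ (fun t => (1 - a 0 t)) * ex ν (fun t => (1 - b 0 t)) := by
    rw [show (fun p : γ × β => a 0 p.1 + b 0 p.2 - a 0 p.1 * b 0 p.2) = fun p => (fun _ => (1:ℝ)) p - (fun p : γ × β => (1 - a 0 p.1) * (1 - b 0 p.2)) p from funext fun p => by ring]
    rw [ex_sub', ex_const hW1, g0]
  have m1 : ex (fun p : γ × β => μ p.1 * ν p.2) (fun p : γ × β => a 1 p.1 + b 1 p.2 - a 1 p.1 * b 1 p.2) = 1 - ex μ (fun t => (1 - a 1 t)) * ex ν (fun t => (1 - b 1 t)) := by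
    rw [show (fun p : γ × β => a 1 p.1 + b 1 p.2 - a 1 p.1 * b 1 p.2) = fun p => (fun _ => (1:ℝ)) p - (fun p : γ × β => (1 - a 1 p.1) * (1 - b 1 p.2)) p from funext fun p => by ring]
    rw [ex_sub', ex_const hW1, g1]
  have m01 : ex (fun p : γ × β => μ p.1 * ν p.2) ((fun p : γ × β => a 0 p.1 + b 0 p.2 - a 0 p.1 * b 0 p.2) * (fun p : γ × β => a 1 p.1 + b 1 p.2 - a 1 p.1 * b 1 p.2))
      = 1 - ex μ (fun t => (1 - a 0 t)) * ex ν (fun t => (1 - b 0 t)) - ex μ (fun t => (1 - a 1 t)) * ex ν (fun t => (1 - b 1 t)) + ex μ (fun t => (1 - a 0 t) * (1 - a 1 t)) * ex ν (fun t => (1 - b 0 t) * (1 - b 1 t)) := by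
    rw [show (fun p : γ × β => a 0 p.1 + b 0 p.2 - a 0 p.1 * b 0 p.2) * (fun p : γ × β => a 1 p.1 + b 1 p.2 - a 1 p.1 * b 1 p.2) = fun p => (fun _ => (1:ℝ)) p - (fun p : γ × β => (1 - a 0 p.1) * (1 - b 0 p.2)) p - (fun p : γ × β => (1 - a 1 p.1) * (1 - b 1 p.2)) p + (fun p : γ × β => ((1 - a 0 p.1) * (1 - a 1 p.1)) * ((1 - b 0 p.2) * (1 - b 1 p.2))) p from
      funext fun p => by simp only [Pi.mul_apply]; ring]
    rw [ex_add', ex_sub', ex_sub', ex_const hW1, g0, g1, g01]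
  have m02 : ex (fun p : γ × β => μ p.1 * ν p.2) ((fun p : γ × β => a 0 p.1 + b 0 p.2 - a 0 p.1 * b 0 p.2) * (fun p : γ × β => a 2 p.1 * b 2 p.2)) = ex μ (a 2) * ex ν (b 2) - ex μ (fun t => (1 - a 0 t) * a 2 t) * ex ν (fun t => (1 - b 0 t) * b 2 t) := by
    rw [show (fun p : γ × β => a 0 p.1 + b 0 p.2 - a 0 p.1 * b 0 p.2) * (fun p : γ × β => a 2 p.1 * b 2 p.2) = fun p => (fun p : γ × β => a 2 p.1 * b 2 p.2) p - (fun p : γ × β => ((1 - a 0 p.1) * a 2 p.1) * ((1 - b 0 p.2) * b 2 p.2)) p from funext fun p => by simp only [Pi.mul_apply]; ring]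
    rw [ex_sub', g2, g02]
  have m12 : ex (fun p : γ × β => μ p.1 * ν p.2) ((fun p : γ × β => a 1 p.1 + b 1 p.2 - a 1 p.1 * b 1 p.2) * (fun p : γ × β => a 2 p.1 * b 2 p.2)) = ex μ (a 2) * ex ν (b 2) - ex μ (fun t => (1 - a 1 t) * a 2 t) * ex ν (fun t => (1 - b 1 t) * b 2 t) := by
    rw [show (fun p : γ × β => a 1 p.1 + b 1 p.2 - a 1 p.1 * b 1 p.2) * (fun p : γ × β => a 2 p.1 * b 2 p.2) = fun p => (fun p : γ × β => a 2 p.1 * b 2 p.2) p - (fun p : γ × β => ((1 - a 1 p.1) * a 2 p.1) * ((1 - b 1 p.2) * b 2 p.2)) p from funext fun p => by simp only [Pi.mul_apply]; ring]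
    rw [ex_sub', g2, g12]
  have m012 : ex (fun p : γ × β => μ p.1 * ν p.2) ((fun p : γ × β => a 0 p.1 + b 0 p.2 - a 0 p.1 * b 0 p.2) * (fun p : γ × β => a 1 p.1 + b 1 p.2 - a 1 p.1 * b 1 p.2) * (fun p : γ × β => a 2 p.1 * b 2 p.2))
      = ex μ (a 2) * ex ν (b 2) - ex μ (fun t => (1 - a 0 t) * a 2 t) * ex ν (fun t => (1 - b 0 t) * b 2 t) - ex μ (fun t => (1 - a 1 t) * a 2 t) * ex ν (fun t => (1 - b 1 t) * b 2 t) + ex μ (fun t => (1 - a 0 t) * (1 - a 1 t) * a 2 t) * ex ν (fun t => (1 - b 0 t) * (1 - b 1 t) * b 2 t) := by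
    rw [show (fun p : γ × β => a 0 p.1 + b 0 p.2 - a 0 p.1 * b 0 p.2) * (fun p : γ × β => a 1 p.1 + b 1 p.2 - a 1 p.1 * b 1 p.2) * (fun p : γ × β => a 2 p.1 * b 2 p.2) = fun p => (fun p : γ × β => a 2 p.1 * b 2 p.2) p - (fun p : γ × β => ((1 - a 0 p.1) * a 2 p.1) * ((1 - b 0 p.2) * b 2 p.2)) p - (fun p : γ × β => ((1 - a 1 p.1) * a 2 p.1) * ((1 - b 1 p.2) * b 2 p.2)) p + (fun p : γ × β => ((1 - a 0 p.1) * (1 - a 1 p.1) * a 2 p.1) * ((1 - b 0 p.2) * (1 - b 1 p.2) * b 2 p.2)) p from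
      funext fun p => by simp only [Pi.mul_apply]; ring]
    rw [ex_add', ex_sub', ex_sub', g2, g02, g12, g012]
  rw [sahiE_three, m012, m0, m1, g2, m12, m02, m01]
  exact e3MixedOOA_nonneg _ _ _ _ _ _ _ _ _ _ _ _ _ _ hx0 hx1 hx0' hx01a hx01b hal hP0 hP1 hP01 hP01a hP01b hT hK0 hK1 hR hk heA
    hy0 hy1 hy0' hy01a hy01b hbe hQ0 hQ1 hQ01 hQ01a hQ01b hU hL0 hL1 hS hl hfB

/-- **Lattice level, mixed (OR, OR, AND)**: positively associated weights on finite preorders, monotone `[0,1]`-valued `a_i`, `b_i` with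
`E₃(a) ≥ 0` and `E₃(b) ≥ 0` ⇒ `E₃^{μ⊗ν}(a_0 ⊕ b_0 − a_0b_0, a_1 ⊕ b_1 − a_1b_1, a_2b_2) ≥ 0`.  With `sahiE_three_por_nonneg_of_sahiPositive_two` (all OR)
and `sahiE_three_pand_nonneg_of_sahiPositive_two` (all AND) — and `E₃`'s symmetry — every member-wise choice of gates in `{AND, OR}` at a block preserves
`E₃ ≥ 0` except the pattern (OR, AND, AND), which is the companion `…MixedOAA` (if/when landed). [this work] -/
theorem sahiE_three_ooa_nonneg_of_sahiPositive_two {γ β : Type*} [Fintype γ] [Fintype β] [Preorder γ] [Preorder β] (μ : γ → ℝ) (ν : β → ℝ)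
    (hμ0 : ∀ t, 0 ≤ μ t) (hμ1 : ∑ t, μ t = 1) (hν0 : ∀ t, 0 ≤ ν t) (hν1 : ∑ t, ν t = 1)
    (hμ2 : SahiPositive μ 2) (hν2 : SahiPositive ν 2)
    (a : Fin 3 → γ → ℝ) (b : Fin 3 → β → ℝ) (ha0 : ∀ i t, 0 ≤ a i t) (ha1 : ∀ i t, a i t ≤ 1) (ham : ∀ i, Monotone (a i))
    (hb0 : ∀ i t, 0 ≤ b i t) (hb1 : ∀ i t, b i t ≤ 1) (hbm : ∀ i, Monotone (b i)) (hea : 0 ≤ sahiE μ 3 a) (heb : 0 ≤ sahiE ν 3 b) :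
    0 ≤ sahiE (fun p : γ × β => μ p.1 * ν p.2) 3 ![(fun p : γ × β => a 0 p.1 + b 0 p.2 - a 0 p.1 * b 0 p.2),
      (fun p : γ × β => a 1 p.1 + b 1 p.2 - a 1 p.1 * b 1 p.2), (fun p : γ × β => a 2 p.1 * b 2 p.2)] := by
  have haa : Monotone (a 0 * a 1) := (ham 0).mul (ham 1) (ha0 0) (ha0 1)
  have hbb : Monotone (b 0 * b 1) := (hbm 0).mul (hbm 1) (hb0 0) (hb0 1)
  exact sahiE_three_ooa_nonneg μ ν hμ0 hμ1 hν0 hν1 a b ha0 ha1 hb0 hb1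
    (ex_mul_le_of_sahiPositive_two μ hμ2 _ _ (ha0 0) (ha0 1) (ham 0) (ham 1))
    (ex_mul_le_of_sahiPositive_two μ hμ2 _ _ (ha0 0) (ha0 2) (ham 0) (ham 2))
    (ex_mul_le_of_sahiPositive_two μ hμ2 _ _ (ha0 1) (ha0 2) (ham 1) (ham 2))
    (ex_mul_le_of_sahiPositive_two μ hμ2 _ _ (fun t => mul_nonneg (ha0 0 t) (ha0 1 t)) (ha0 2) haa (ham 2)) hea
    (ex_mul_le_of_sahiPositive_two ν hν2 _ _ (hb0 0) (hb0 1) (hbm 0) (hbm 1))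
    (ex_mul_le_of_sahiPositive_two ν hν2 _ _ (hb0 0) (hb0 2) (hbm 0) (hbm 2))
    (ex_mul_le_of_sahiPositive_two ν hν2 _ _ (hb0 1) (hb0 2) (hbm 1) (hbm 2))
    (ex_mul_le_of_sahiPositive_two ν hν2 _ _ (fun t => mul_nonneg (hb0 0 t) (hb0 1 t)) (hb0 2) hbb (hbm 2)) heb

end Summit.CriticalPhenomena.PercolationContinuityZ3.Theorems.SahiE3UnionTensor

end
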